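import Literature.AnabelianGeometry.Anabelioids.ExactFunctorProofs
import Literature.AnabelianGeometry.Anabelioids.FiberFunctorUnique
import Literature.AnabelianGeometry.Anabelioids.FreeFibres
import Literature.AnabelianGeometry.SemiGraphs.GraphOfAnabelioids
import Literature.GroupTheory.PermutationGroups.FreeFiniteActions

/-!
# Free finite étale coverings of a semi-graph of anabelioids of bounded order

Mochizuki, *Inter-universal Teichmüller theory I*, Rmk. 2.5.3 (i) (T4) p. 53 [cite: Mochizuki2012,
IUTchI Rem. 2.5.3(i)(T4) p.53] ("one verifies immediately that every strictly coherent, countable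
semi-graph of anabelioids is Galois-countable"), the construction step: over a semi-graph of anabelioids
`𝒢'` of injective type all of whose constituent fundamental groups are FINITE of order dividing `M`
(the target of an approximator, [SemiAnbd] Def. 2.3 (ii)), there is an object `A' = {S_v, T_e, ψ_b}` of
`B(𝒢')` all of whose constituents have FREE fibres with exactly `M` points (`exists_free_bObj`): take
`S_v`, `T_e` free of size `M` (`exists_obj_free_fiber`); `b^* S_v` is again free of size `M` because
`Π_e → Π_v` is injective, and two free `Π_e`-sets of the same size are isomorphic, which provides the
gluing `ψ_b`.  Proof-only (no definitions).
-/

namespace Literature.AnabelianGeometry.SemiGraphs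

open CategoryTheory CategoryTheory.Limits CategoryTheory.PreGaloisCategory
open Literature.AnabelianGeometry.Anabelioids
open Literature.GroupTheory.PermutationGroups

universe v₁ u₁ u

namespace SemiGraphOfAnabelioids

variable (𝒢 : SemiGraphOfAnabelioids.{v₁, u₁, u})

/-- Free fibres at one basepoint are free at every basepoint, with the same cardinality.
[cite: MochizukiGeoAn2004, §1.1 p.10] -/
theorem free_fiber_forall {C : Type u₁} [Category.{v₁} C] [GaloisCategory C]
    (F₀ : C ⥤ FintypeCat.{v₁}) [FiberFunctor F₀] (S : C)
    (h : ∀ (σ : Aut F₀) (x : F₀.obj S), σ • x = x → σ = 1) (F : C ⥤ FintypeCat.{v₁})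
    [FiberFunctor F] : (∀ (σ : Aut F) (x : F.obj S), σ • x = x → σ = 1) ∧
      Nat.card (F.obj S) = Nat.card (F₀.obj S) := by
  obtain ⟨α⟩ := nonempty_iso_of_fiberFunctor F₀ F
  exact ⟨free_fiber_of_iso α S h, Nat.card_congr (FintypeCat.equivEquivIso.symm (α.app S)).symm⟩

/-- **Free coverings over a semi-graph of anabelioids of bounded order.**  If `𝒢'` is of injective
type, every edge of `𝒢'` has an abutting branch, and all fundamental groups of the vertex constituents
are finite of order dividing `M`, then `B(𝒢')` has an object all of whose constituents have free fibres
with exactly `M` points. [cite: Mochizuki2012, IUTchI Rem. 2.5.3(i)(T4) p.53] -/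
theorem exists_free_bObj (M : ℕ)
    (hfin : ∀ (v : 𝒢.graph.Vertex) (F : 𝒢.V v ⥤ FintypeCat.{v₁}) [FiberFunctor F],
      Finite (Aut F) ∧ Nat.card (Aut F) ∣ M)
    (hinj : 𝒢.IsOfInjectiveType)
    (habut : ∀ e : 𝒢.graph.Edge, ∃ (b : 𝒢.graph.Branch) (v : 𝒢.graph.Vertex),
      𝒢.graph.edgeOf b = e ∧ 𝒢.graph.abuts b = some v) :
    ∃ A : 𝒢.BObj,
      (∀ (v : 𝒢.graph.Vertex) (F : 𝒢.V v ⥤ FintypeCat.{v₁}) [FiberFunctor F],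
        (∀ (σ : Aut F) (x : F.obj (A.S v)), σ • x = x → σ = 1) ∧ Nat.card (F.obj (A.S v)) = M) ∧
      ∀ (e : 𝒢.graph.Edge) (F : 𝒢.E e ⥤ FintypeCat.{v₁}) [FiberFunctor F],
        (∀ (σ : Aut F) (x : F.obj (A.T e)), σ • x = x → σ = 1) ∧ Nat.card (F.obj (A.T e)) = M := by
  classical
  -- edge groups are finite of order dividing `M` too (they inject into a vertex group)
  have hfinE : ∀ (e : 𝒢.graph.Edge) (F : 𝒢.E e ⥤ FintypeCat.{v₁}) [FiberFunctor F],
      Finite (Aut F) ∧ Nat.card (Aut F) ∣ M := by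
    intro e F _
    obtain ⟨b, v, hbe, hbv⟩ := habut e
    subst hbe
    let P := (𝒢.pull b v hbv).pullback
    haveI : FiberFunctor (P ⋙ F) := fiberFunctor_comp_of_exact P F
    obtain ⟨hf, hd⟩ := hfin v (P ⋙ F)
    have hi : Function.Injective (pi1Map P F) := hinj.isPi1Mono b v hbv F
    haveI : Finite (Aut F) := Finite.of_injective _ hi
    refine ⟨inferInstance, ?_⟩
    exact dvd_trans (Subgroup.card_dvd_of_injective _ hi) hd
  -- free constituents of size `M`
  have hS : ∀ v : 𝒢.graph.Vertex, ∃ S : 𝒢.V v, ∀ (F : 𝒢.V v ⥤ FintypeCat.{v₁}) [FiberFunctor F],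
      (∀ (σ : Aut F) (x : F.obj S), σ • x = x → σ = 1) ∧ Nat.card (F.obj S) = M := by
    intro v
    let F₀ := GaloisCategory.getFiberFunctor (𝒢.V v)
    obtain ⟨hf, hd⟩ := hfin v F₀
    haveI := hf
    obtain ⟨k, hk⟩ := hd
    obtain ⟨S, hfree, hcard⟩ := exists_obj_free_fiber F₀ k
    refine ⟨S, fun F _ => ?_⟩
    obtain ⟨h1, h2⟩ := free_fiber_forall F₀ S hfree F
    exact ⟨h1, by rw [h2, hcard, hk, mul_comm]⟩
  have hT : ∀ e : 𝒢.graph.Edge, ∃ T : 𝒢.E e, ∀ (F : 𝒢.E e ⥤ FintypeCat.{v₁}) [FiberFunctor F],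
      (∀ (σ : Aut F) (x : F.obj T), σ • x = x → σ = 1) ∧ Nat.card (F.obj T) = M := by
    intro e
    let F₀ := GaloisCategory.getFiberFunctor (𝒢.E e)
    obtain ⟨hf, hd⟩ := hfinE e F₀
    haveI := hf
    obtain ⟨k, hk⟩ := hd
    obtain ⟨T, hfree, hcard⟩ := exists_obj_free_fiber F₀ k
    refine ⟨T, fun F _ => ?_⟩
    obtain ⟨h1, h2⟩ := free_fiber_forall F₀ T hfree F
    exact ⟨h1, by rw [h2, hcard, hk, mul_comm]⟩
  choose S hS using hS
  choose T hT using hT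
  -- gluing: `b^* S_v` and `T_e` are both free of size `M` under a basepoint of `𝒢_e`
  have hψ : ∀ (b : 𝒢.graph.Branch) (v : 𝒢.graph.Vertex) (h : 𝒢.graph.abuts b = some v),
      Nonempty ((𝒢.pull b v h).pullback.obj (S v) ≅ T (𝒢.graph.edgeOf b)) := by
    intro b v h
    let P := (𝒢.pull b v h).pullback
    let Fe := GaloisCategory.getFiberFunctor (𝒢.E (𝒢.graph.edgeOf b))
    haveI : FiberFunctor (P ⋙ Fe) := fiberFunctor_comp_of_exact P Fe
    haveI : Finite (Aut Fe) := (hfinE _ Fe).1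
    obtain ⟨hfreeS, hcardS⟩ := hS v (P ⋙ Fe)
    obtain ⟨hfreeT, hcardT⟩ := hT (𝒢.graph.edgeOf b) Fe
    have hfree1 : ∀ (σ : Aut Fe) (x : Fe.obj (P.obj (S v))), σ • x = x → σ = 1 :=
      free_fiber_of_pi1Map_injective P Fe (S v) (hinj.isPi1Mono b v h Fe) hfreeS
    obtain ⟨ε, hε⟩ := exists_equivariant_equiv_of_free (G := Aut Fe) hfree1 hfreeT
      (by rw [hcardT]; exact hcardS)
    exact nonempty_iso_of_equivariant_equiv Fe ε hε
  refine ⟨{ S := S, T := T, ψ := fun b v h => (hψ b v h).some }, fun v F _ => hS v F,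
    fun e F _ => hT e F⟩

end SemiGraphOfAnabelioids

end Literature.AnabelianGeometry.SemiGraphs
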